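import Summits.CriticalPhenomena.PercolationContinuityZ3.Theorems.Transplant.SiteWorldDefs
import HarnessLib

/-!
# SITE percolation: the induction skeleton of the site conditioned slack hierarchy (WP7 socket of P1-SITE-Z3 §12)
# (lane `prim-bschramm`, class C1a; site twin of `CSH.cshMargin_nonneg_of_unfold` / `CSH.cshHolds_of_unfold`)

builds on p205010 (kernel theorem, internal audit signed; external expert review pending).

The bond proof of MEMO THEOREM 1 (`CSH.cshHolds`, p205010) is a strong induction on the number of decoys: base = MDL(X) (level zero),
step = LEMMA T (reduce the margin to the WITHIN margin, computed world by world) + LEMMAS U/H (the within margin is nonnegative given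
the LOWER-level margins).  This file is the SITE socket of that induction, with the three analytic inputs as NAMED HYPOTHESES whose exact
Lean shapes are thereby fixed for the work packages of the site re-typing plan:
* `hBase` — site MDL(X) (WP2): `0 ≤ SiteCSH.cshMargin Γ q x Y [] o v f` for `v ∉ insert x Y`, `f` monotone;
* `hT`   — site LEMMA T (WP1): for a datum `(x, Y, D, o, v)`, if the site within margin `siteWithin Γ q x Y D o v g ≥ 0` for every
           monotone `g ≥ 0`, then `0 ≤ cshMargin … f` for every monotone `f`;
* `hU`   — site LEMMAS U + H (WP5/WP6): lower-level margins nonnegative ⇒ within margin nonnegative.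
The within margin is `SiteCSH.siteWithin` (defined here): the level form of the WORLD covariances `Cov_{q^ω_Y}(g(C_x), 1{x ↔ u})`,
`q^ω_Y = SiteCSH.worldQ Γ q Y ω` (p211418), integrated over `ω ∈ {x ↮ Y}`.
Results: `siteCshMargin_nonneg_of_unfold` (verbatim the bond bookkeeping), `siteCSHHolds_of_unfold`, and the closed form
**`siteCSHAll_of_unfold`**: the three hypotheses for every finite graph and non-degenerate vertex weights give `SiteCSHAll` — hence, with
p210511, `SiteAdditiveGluing` and site Conjecture 3.
Definitions + proofs (`--supports stmt-CriticalPhenomena-4575 --as helper`); no named facts, no sorries.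
[cite: VandenbergHaggstromKahn2005, §2.1 (pp. 9–13)] [cite: KozmaNitzan2024, Conj. 4 (p. 32)]
-/

noncomputable section

namespace Summit.CriticalPhenomena.PercolationContinuityZ3.Theorems.Transplant

namespace SiteCSH

open MeasureTheory Set
open Literature.Probability.LatticeModels (prodBernoulli)
open Literature.Probability.Percolation
open Summit.CriticalPhenomena.PercolationContinuityZ3.Theorems.CSH (cshMarg)
open Summit.CriticalPhenomena.PercolationContinuityZ3.Theorems.SiteTransplant (siteConn)
open scoped Classical

variable {V : Type*} (Γ : SimpleGraph V)

/-- **The site WITHIN (world-wise) margin** of a functional `g` of the owner's cluster: the level form (decoys `D`, constants conditioned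
on avoiding `{x} ∪ Y ∪` earlier decoys, observers' constant `p`) applied to the WORLD covariances `u ↦ Cov_{q^ω_Y}(g(C_x), 1{x↔u})`,
integrated over the configurations `ω ∈ {x ↮ Y}`.  Site twin of the bond within integrand of `CSH.cshMargin_nonneg_of_within`.
[cite: VandenbergHaggstromKahn2005, §2.1 Lemma 2.4 (p. 10)] -/
def siteWithin (q : V → unitInterval) (x : V) (Y : Set V) (D : List V) (o v : V) (g : Set V → ℝ) : ℝ :=
  ∫ ω in {ω : Set V | ∀ y ∈ Y, y ∉ siteCluster Γ ω x},
    cshMarg (decoyList Γ q (insert x Y) D) (obsConst Γ q o v (insert x Y ∪ {d | d ∈ D})) o v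
      (fun u => (∫ η in siteConn Γ x u, g (siteCluster Γ η x) ∂(prodBernoulli (worldQ Γ q Y ω))) -
        (∫ η, g (siteCluster Γ η x) ∂(prodBernoulli (worldQ Γ q Y ω))) *
          (prodBernoulli (worldQ Γ q Y ω)).real (siteConn Γ x u))
    ∂(prodBernoulli q)

variable {Γ}

/-- **Site Theorem 1 from the three sockets** (strong induction on the number of decoys; verbatim the bond bookkeeping of
`CSH.cshMargin_nonneg_of_unfold`). [cite: KozmaNitzan2024, Conj. 4 (p. 32)] -/
theorem siteCshMargin_nonneg_of_unfold (q : V → unitInterval)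
    (hBase : ∀ (x : V) (Y : Set V) (o v : V), v ∉ insert x Y → ∀ f : Set V → ℝ, Monotone f → 0 ≤ cshMargin Γ q x Y [] o v f)
    (hT : ∀ (x : V) (Y : Set V) (D : List V) (o v : V),
      (∀ g : Set V → ℝ, Monotone g → (∀ C, 0 ≤ g C) → 0 ≤ siteWithin Γ q x Y D o v g) →
      ∀ f : Set V → ℝ, Monotone f → 0 ≤ cshMargin Γ q x Y D o v f)
    (hU : ∀ (x : V) (Y : Set V) (D : List V) (o v : V),
      x ∉ Y → o ∉ insert x Y → v ∉ insert x Y → o ≠ v → D ≠ [] → D.Nodup → (∀ d ∈ D, d ∉ insert x Y ∧ d ≠ o ∧ d ≠ v) →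
      (∀ (pre : List V) (d : V) (ds' : List V), D = pre ++ d :: ds' →
        ∀ h : Set V → ℝ, Monotone h → (∀ C, 0 ≤ h C) → 0 ≤ cshMargin Γ q d (insert x Y ∪ {e | e ∈ pre}) ds' o v h) →
      ∀ g : Set V → ℝ, Monotone g → (∀ C, 0 ≤ g C) → 0 ≤ siteWithin Γ q x Y D o v g) :
    ∀ (D : List V) (x : V) (Y : Set V) (o v : V),
      x ∉ Y → o ∉ insert x Y → v ∉ insert x Y → o ≠ v → D.Nodup → (∀ d ∈ D, d ∉ insert x Y ∧ d ≠ o ∧ d ≠ v) →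
      ∀ f : Set V → ℝ, Monotone f → 0 ≤ cshMargin Γ q x Y D o v f := by
  -- strong induction on the length of the decoy list
  suffices hk : ∀ (k : ℕ) (D : List V), D.length ≤ k → ∀ (x : V) (Y : Set V) (o v : V),
      x ∉ Y → o ∉ insert x Y → v ∉ insert x Y → o ≠ v → D.Nodup → (∀ d ∈ D, d ∉ insert x Y ∧ d ≠ o ∧ d ≠ v) →
      ∀ f : Set V → ℝ, Monotone f → 0 ≤ cshMargin Γ q x Y D o v f from
    fun D => hk D.length D le_rfl
  intro k
  induction k with
  | zero =>
    intro D hD x Y o v _ _ hv _ _ _ f hf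
    have hD0 : D = [] := List.eq_nil_of_length_eq_zero (Nat.le_zero.1 hD)
    subst hD0
    exact hBase x Y o v hv f hf
  | succ k ih =>
    intro D hD x Y o v hxY ho hv hov hnd hdis f hf
    by_cases hnil : D = []
    · subst hnil
      exact hBase x Y o v hv f hf
    -- Lemma T (site): reduce to the world-wise margin
    refine hT x Y D o v (fun g hg hg0 => ?_) f hf
    refine hU x Y D o v hxY ho hv hov hnil hnd hdis (fun pre d ds' hsplit h hh hh0 => ?_) g hg hg0
    -- the lower level `(d | {x} ∪ Y ∪ pre ; ds')` has fewer decoys: induction hypothesis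
    have hlen : ds'.length ≤ k := by
      have : D.length = pre.length + (ds'.length + 1) := by rw [hsplit, List.length_append, List.length_cons]
      omega
    have hdD : d ∈ D := by rw [hsplit]; exact List.mem_append_right pre List.mem_cons_self
    have hpreD : ∀ e ∈ pre, e ∈ D := fun e he => by rw [hsplit]; exact List.mem_append_left _ he
    have hds'D : ∀ e ∈ ds', e ∈ D := fun e he => by rw [hsplit]; exact List.mem_append_right pre (List.mem_cons_of_mem d he)
    have hnd' : (pre ++ d :: ds').Nodup := hsplit ▸ hnd
    have hnd_ds' : ds'.Nodup := (List.nodup_cons.1 (List.nodup_append.1 hnd').2.1).2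
    have hd_notin_ds' : d ∉ ds' := (List.nodup_cons.1 (List.nodup_append.1 hnd').2.1).1
    have hd_notin_pre : d ∉ pre := fun hdp =>
      (List.nodup_append.1 hnd').2.2 d hdp d List.mem_cons_self rfl
    have hds'_notin_pre : ∀ e ∈ ds', e ∉ pre := fun e he hep =>
      (List.nodup_append.1 hnd').2.2 e hep e (List.mem_cons_of_mem d he) rfl
    set Y' : Set V := insert x Y ∪ {e | e ∈ pre} with hY'
    have hdY' : d ∉ Y' := by
      rintro (h1 | h2)
      · exact (hdis d hdD).1 h1
      · exact hd_notin_pre h2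
    have hoY' : o ∉ insert d Y' := by
      rintro (h0 | h1 | h2)
      · exact (hdis d hdD).2.1 h0.symm
      · exact ho h1
      · exact (hdis o (hpreD o h2)).2.1 rfl
    have hvY' : v ∉ insert d Y' := by
      rintro (h0 | h1 | h2)
      · exact (hdis d hdD).2.2 h0.symm
      · exact hv h1
      · exact (hdis v (hpreD v h2)).2.2 rfl
    have hdis' : ∀ e ∈ ds', e ∉ insert d Y' ∧ e ≠ o ∧ e ≠ v := by
      intro e he
      refine ⟨?_, (hdis e (hds'D e he)).2.1, (hdis e (hds'D e he)).2.2⟩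
      rintro (h0 | h1 | h2)
      · exact hd_notin_ds' (h0 ▸ he)
      · exact (hdis e (hds'D e he)).1 h1
      · exact hds'_notin_pre e he h2
    exact ih ds' hlen d Y' o v hdY' hoY' hvY' hov hnd_ds' hdis' h hh

/-- **`SiteCSHHolds` for every datum from the three sockets.** [cite: KozmaNitzan2024, Conj. 4 (p. 32)] -/
theorem siteCSHHolds_of_unfold (q : V → unitInterval)
    (hBase : ∀ (x : V) (Y : Set V) (o v : V), v ∉ insert x Y → ∀ f : Set V → ℝ, Monotone f → 0 ≤ cshMargin Γ q x Y [] o v f)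
    (hT : ∀ (x : V) (Y : Set V) (D : List V) (o v : V),
      (∀ g : Set V → ℝ, Monotone g → (∀ C, 0 ≤ g C) → 0 ≤ siteWithin Γ q x Y D o v g) →
      ∀ f : Set V → ℝ, Monotone f → 0 ≤ cshMargin Γ q x Y D o v f)
    (hU : ∀ (x : V) (Y : Set V) (D : List V) (o v : V),
      x ∉ Y → o ∉ insert x Y → v ∉ insert x Y → o ≠ v → D ≠ [] → D.Nodup → (∀ d ∈ D, d ∉ insert x Y ∧ d ≠ o ∧ d ≠ v) →
      (∀ (pre : List V) (d : V) (ds' : List V), D = pre ++ d :: ds' →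
        ∀ h : Set V → ℝ, Monotone h → (∀ C, 0 ≤ h C) → 0 ≤ cshMargin Γ q d (insert x Y ∪ {e | e ∈ pre}) ds' o v h) →
      ∀ g : Set V → ℝ, Monotone g → (∀ C, 0 ≤ g C) → 0 ≤ siteWithin Γ q x Y D o v g)
    (x : V) (Y : Set V) (D : List V) (o v : V)
    (hxY : x ∉ Y) (ho : o ∉ insert x Y) (hv : v ∉ insert x Y) (hov : o ≠ v) (hnd : D.Nodup)
    (hdis : ∀ d ∈ D, d ∉ insert x Y ∧ d ≠ o ∧ d ≠ v) :
    SiteCSHHolds Γ q x Y D o v :=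
  fun f hf => siteCshMargin_nonneg_of_unfold q hBase hT hU D x Y o v hxY ho hv hov hnd hdis f hf

/-- **`SiteCSHAll` from the three sockets on every finite graph with non-degenerate vertex weights** (the closed form consumed by
`SiteCSH.siteAdditiveGluing_of_siteCSHAll`, p210511). [cite: KozmaNitzan2024, Conj. 4 (p. 32)] -/
theorem siteCSHAll_of_unfold
    (h : ∀ (n : ℕ) (Γ : SimpleGraph (Fin n)) (q : Fin n → unitInterval), (∀ u, 0 < q u ∧ q u < 1) →
      (∀ (x : Fin n) (Y : Set (Fin n)) (o v : Fin n), v ∉ insert x Y →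
          ∀ f : Set (Fin n) → ℝ, Monotone f → 0 ≤ cshMargin Γ q x Y [] o v f) ∧
      (∀ (x : Fin n) (Y : Set (Fin n)) (D : List (Fin n)) (o v : Fin n),
          (∀ g : Set (Fin n) → ℝ, Monotone g → (∀ C, 0 ≤ g C) → 0 ≤ siteWithin Γ q x Y D o v g) →
          ∀ f : Set (Fin n) → ℝ, Monotone f → 0 ≤ cshMargin Γ q x Y D o v f) ∧
      (∀ (x : Fin n) (Y : Set (Fin n)) (D : List (Fin n)) (o v : Fin n),
          x ∉ Y → o ∉ insert x Y → v ∉ insert x Y → o ≠ v → D ≠ [] → D.Nodup →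
          (∀ d ∈ D, d ∉ insert x Y ∧ d ≠ o ∧ d ≠ v) →
          (∀ (pre : List (Fin n)) (d : Fin n) (ds' : List (Fin n)), D = pre ++ d :: ds' →
            ∀ h : Set (Fin n) → ℝ, Monotone h → (∀ C, 0 ≤ h C) →
              0 ≤ cshMargin Γ q d (insert x Y ∪ {e | e ∈ pre}) ds' o v h) →
          ∀ g : Set (Fin n) → ℝ, Monotone g → (∀ C, 0 ≤ g C) → 0 ≤ siteWithin Γ q x Y D o v g)) :
    SiteCSHAll := by
  intro n Γ q hq o v x Y D hov hxY hox hvx hoY hvY hnd hdis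
  obtain ⟨hBase, hT, hU⟩ := h n Γ q hq
  refine siteCSHHolds_of_unfold (Γ := Γ) q hBase hT hU x (↑Y : Set (Fin n)) D o v (fun h => hxY (Finset.mem_coe.1 h)) ?_ ?_ hov hnd ?_
  · rintro (h | h)
    · exact hox h
    · exact hoY (Finset.mem_coe.1 h)
  · rintro (h | h)
    · exact hvx h
    · exact hvY (Finset.mem_coe.1 h)
  · intro d hd
    obtain ⟨h1, h2, h3, h4⟩ := hdis d hd
    refine ⟨?_, h3, h4⟩
    rintro (h | h)
    · exact h1 h
    · exact h2 (Finset.mem_coe.1 h)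

end SiteCSH

end Summit.CriticalPhenomena.PercolationContinuityZ3.Theorems.Transplant
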